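import Mathlib.FieldTheory.Finite.GaloisField
import Literature.Barriers.PneNP.LowDegreeCounterexamplesCodes
import Literature.Barriers.PneNP.LowDegreeCounterexamplesProofs
import Literature.InformationTheory.Coding.SubfieldImage
import HarnessLib

/-!
# Barrier catalogue `PneNP`, Holmgren–Wein 2021: Prop. 3 reduced to Guruswami's
algebraic-geometry codes over `𝔽₆₄` (Shpilka 2009, App. A, Thm. 24 — Lemmas 25–26 proved)

`Literature/Barriers/PneNP/LowDegreeCounterexamplesCodes.lean` vendors Holmgren–Wein's Prop. 3
(binary linear codes of length `42·8^{i+1}` with dual distance `≥ ζn`, `ζ ≥ 1/30`, uniquely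
decodable in polynomial time from `ζn/2` errors) as the named fact `DecodableDualDistanceCodes`,
the single open leaf below the barrier fact `LowDegreeCounterexamples` (Holmgren–Wein Thm. 2;
`LowDegreeCounterexamples.of_codes`). Holmgren–Wein take Prop. 3 from [Shpilka 2009, Thm. 4],
whose proof is Appendix A there, written by V. Guruswami (held; `lit read
doi:10.1007/s00037-009-0281-5`, pp. 23–26). That appendix has three steps:

1. **Thm. 24** (p. 25): for every prime power `r ≥ 8` and `m ≥ 1`, an `𝔽_{r²}`-linear code of
   rate `1/2` and block length `n_m = r^{m+1}(r-1)` with relative distance `≥ 1/2 - 1/(r-1)`,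
   whose dual has relative distance `≥ 1/3`, with "a representation ... constructed in
   `poly(n_m)` time that enables ... deterministic polynomial time decoding from a fraction
   `1/10` of errors" — algebraic-geometry codes `C(D, α_m P_∞)` on the Garcia–Stichtenoth tower
   (Lemma 22: `k ≥ α - g + 1`, `d ≥ n - α`, dual distance `≥ α - (2g-2)`; Thm. 23: a
   Welch–Berlekamp-type unique decoder up to `⌊(d* - g - 1)/2⌋` errors);
2. **Lemma 25** (p. 26): expressing symbols of `𝔽_{2^s}` in a (self-dual) `𝔽₂`-basis respects
   duals, `SD(C^⊥) = SD(C)^⊥` ("the proof is standard and omitted");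
3. **Lemma 26** (p. 26): the binary image keeps the rate, has relative distance `≥ 1/s` times
   that of `C`, and "an algorithm to correct a fraction `γ` of errors for `C` implies an
   algorithm to correct a fraction `γ/s` of errors for `SD(C)`";

and concludes (p. 26): over `𝔽₆₄` (`r = 8`, `s = 6`) "polynomial time constructible rate `1/2`
binary linear codes decodable in deterministic polynomial time from a fraction `1/60` of errors
and whose duals have relative distance at least `1/18`" — of length `6·7·8^{m+1} = 42·8^{m+1}`.

**What this file does.** Step 2 and the distance half of step 3 are PROVED in the tree for an
arbitrary basis (`Literature/InformationTheory/Coding/SubfieldImage.lean`: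
`dualCode_subfieldImage` — the dual of the image under a basis `B` is the image of the dual
under the trace-dual basis `B^∨`, which is `B` itself when `B` is self-dual —,
`minDist_le_minDist_subfieldImage`, `dualDist_le_dualDist_subfieldImage`, and reindexing). On top
of them this file proves the conclusion of p. 26 as a REDUCTION WITH EXPLICIT HYPOTHESES:

* `DecodableDualDistanceCodes.of_codes64`: from `𝔽₆₄`-linear codes `D_i ≤ 𝔽₆₄^{N_i}`,
  `N_i = 7·8^{i+2}`, whose nonzero dual words have weight `≥ N_i/3` and whose nonzero codewords
  have weight `≥ (1/2 - 1/7)N_i` (Thm. 24's parameters at `r = 8`), together with polynomial-time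
  bounded-distance decoding of their binary images from a fraction `1/60` of errors (Thm. 24's
  decoder through the algorithmic half of Lemma 26, in the `P`-language form of
  `DecodableDualDistanceCodes` (c)), to `DecodableDualDistanceCodes` with `ζ = 1/30` (binary dual
  distance `≥ N/3 = n/18 ≥ n/30`, binary distance `≥ (1/2 - 1/7)N = 5n/84 > 2⌊n/60⌋`, decoding
  radius `θ ≤ ζ/2 = 1/60`); whence `LowDegreeCounterexamples.of_codes64`.

The hypotheses are exactly what is not formalised: the Garcia–Stichtenoth tower with Riemann–Roch
on it behind the two weight bounds (Lemma 22 and the arithmetic of p. 25 ARE proved, in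
`LowDegreeCounterexamplesCodes64GS.lean`, which reduces the weight bounds to one-point data over
`𝔽₆₄` of genus `≤ 8^{i+2}` — the named fact `GarciaStichtenothOnePoint64` there — and proves
`DecodableDualDistanceCodes.of_onePointData`), and a machine-level polynomial-time decoder (Thm. 23
with [SAK+01]) — towers of function fields and machine-level running time, neither of which Mathlib
can currently express. An earlier version of this file bundled these hypotheses as a named fact
`GuruswamiCodes64` ("Thm. 24 at `r = 8` with the binary-image decoder"). As a decomposition child of
`DecodableDualDistanceCodes` it isolated nothing smaller than its parent — its unformalised content
(tower and decoder) is the parent's entire unformalised content, the split having peeled off only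
Lemmas 25–26 — and its decoding clause was the parent's `bddLanguage` clause rather than Thm. 24's
symbol-level statement; it was therefore merged back into the hypotheses of
`DecodableDualDistanceCodes.of_codes64` (D-0026 review, 2026-08-15). This file declares no named
fact.

Conventions: `agLength i = 7·8^{i+2}` is Thm. 24's `n_m = r^{m+1}(r-1)` at `r = 8`, `m = i+1`
(so that `6 · agLength i = hwLength i = 42·8^{i+2}`, the tree's re-indexing of the paper's
lengths); `F64 = GaloisField 2 6`; the binary image is taken in a fixed `𝔽₂`-basis `basis64` of
`𝔽₆₄` (any basis works for the inequalities and for decodability; the source's self-dual basis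
is only needed for the exact equality of Lemma 25) and re-indexed `Fin N × Fin 6 ≃ Fin (6N)`.

## References

* A. Shpilka, *Constructions of low-degree and error-correcting ε-biased generators*, comput.
  complexity 18 (2009) 495–525, doi:10.1007/s00037-009-0281-5 — Thm. 4 (p. 7); Appendix A by
  V. Guruswami: Lemma 22, Thm. 23 (p. 24), Thm. 24 (p. 25), Lemmas 25–26 and conclusion (p. 26).
  Held.
* J. Holmgren, A. S. Wein, *Counterexamples to the low-degree conjecture*, ITCS 2021, Prop. 3
  (arXiv:2004.08454 p. 7; LIPIcs Prop. 12: "A proof (by Guruswami) can be found in [26, Thm. 4]").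
  Held.
-/

noncomputable section

namespace Literature.Barriers.PneNP

open Matrix Literature.InformationTheory.Coding

/-! ### The field `𝔽₆₄`, symbol lengths, and binary images -/

/-- The field `𝔽₆₄ = 𝔽_{r²}`, `r = 8` (Mathlib's `GaloisField 2 6`).
[cite: Shpilka2009, App. A, Thm. 24 and p. 26 ("over the field 𝔽₆₄")] -/
abbrev F64 : Type := GaloisField 2 6

/-- Classical decidable equality on `𝔽₆₄` (needed to count nonzero coordinates). [folklore] -/
instance instDecidableEqF64 : DecidableEq F64 := Classical.decEq F64

/-- A fixed `𝔽₂`-basis of `𝔽₆₄`, indexed by `Fin 6` (`[𝔽₆₄ : 𝔽₂] = 6`, `GaloisField.finrank`).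
[folklore] -/
def basis64 : Module.Basis (Fin 6) (ZMod 2) F64 :=
  Module.finBasisOfFinrankEq (ZMod 2) F64 (GaloisField.finrank 2 (n := 6) (by norm_num))

/-- The symbol block lengths `N_i = 7 · 8^{i+2}`: Thm. 24's `n_m = r^{m+1}(r-1)` at `r = 8`,
`m = i + 1` (re-indexed from `0` like `hwLength`). [cite: Shpilka2009, App. A, Thm. 24] -/
def agLength (i : ℕ) : ℕ := 7 * 8 ^ (i + 2)

/-- Six bits per symbol: `N_i · 6 = hwLength i = 42 · 8^{i+2}`. [cite: Shpilka2009, App. A, p. 26] -/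
theorem agLength_mul_six (i : ℕ) : agLength i * 6 = hwLength i := by
  simp only [agLength, hwLength]
  ring

/-- The symbol block lengths are positive (`≥ 448`). [folklore] -/
theorem agLength_pos (i : ℕ) : 0 < agLength i := by
  simp only [agLength]
  positivity

/-- The coordinate identification `Fin N_i × Fin 6 ≃ Fin (hwLength i)` (symbol `j`, bit `t` ↦
position `6j + t`). [folklore] -/
def binIdx (i : ℕ) : Fin (agLength i) × Fin 6 ≃ Fin (hwLength i) :=
  finProdFinEquiv.trans (finCongr (agLength_mul_six i))

/-- **The binary image** of an `𝔽₆₄`-linear code of length `N_i`, as a binary linear code of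
length `hwLength i = 6 N_i`: expand every symbol in the basis `basis64`
(`Literature.InformationTheory.Coding.subfieldImage`) and re-index the coordinates by `binIdx`.
[cite: Shpilka2009, App. A, Lemma 25–26 (p. 26: "expressing the symbols from 𝔽_{2^s} ... with respect to a fixed ... basis")] -/
def binaryImage (i : ℕ) (D : Submodule F64 (Fin (agLength i) → F64)) :
    Submodule (ZMod 2) (Fin (hwLength i) → ZMod 2) :=
  InformationTheory.Coding.reindex (binIdx i) (subfieldImage basis64 D)

/-- The binary image has `𝔽₂`-dimension six times the `𝔽₆₄`-dimension of the code, so with the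
block length `6N_i` the rate is preserved (Lemma 26, rate part).
[cite: Shpilka2009, App. A, Lemma 26 (p. 26: "the rate of SD(C) is the same as that of C")] -/
theorem finrank_binaryImage (i : ℕ) (D : Submodule F64 (Fin (agLength i) → F64)) :
    Module.finrank (ZMod 2) (binaryImage i D) = 6 * Module.finrank F64 D := by
  rw [binaryImage, InformationTheory.Coding.reindex, ← LinearEquiv.finrank_eq
    (Submodule.equivMapOfInjective _ (LinearEquiv.funCongrLeft (ZMod 2) (ZMod 2) (binIdx i).symm).injective _),
    subfieldImage, ← LinearEquiv.finrank_eq (Submodule.equivMapOfInjective _ (expand_injective basis64) _)]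
  change Module.finrank (ZMod 2) (D : Submodule F64 (Fin (agLength i) → F64)) = _
  rw [← Module.finrank_mul_finrank (ZMod 2) F64 D, GaloisField.finrank 2 (n := 6) (by norm_num)]

/-! ### From symbol-level parameters to the binary leaf -/

/-- A real lower bound on all nonzero dual weights gives a lower bound on the dual distance:
`(∀ y ⊥ C, y ≠ 0 → a ≤ ‖y‖) → ⌈a⌉ ≤ dualDist C`. [folklore] -/
theorem ceil_le_dualDist {ι F : Type*} [Fintype ι] [Field F] [DecidableEq F] [DecidableEq ι]
    (C : Submodule F (ι → F)) {a : ℝ}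
    (h : ∀ y : ι → F, (∀ c ∈ C, c ⬝ᵥ y = 0) → y ≠ 0 → a ≤ hammingNorm y) :
    ((⌈a⌉₊ : ℕ) : ℕ∞) ≤ dualDist C :=
  le_dualDist_iff.2 fun y hy h0 => by exact_mod_cast Nat.ceil_le.2 (h y hy h0)

/-- A real lower bound on all nonzero codeword weights gives a lower bound on the minimum
distance: `(∀ c ∈ C, c ≠ 0 → a ≤ ‖c‖) → ⌈a⌉ ≤ minDist C`. [folklore] -/
theorem ceil_le_minDist {ι F : Type*} [Fintype ι] [Field F] [DecidableEq F] [DecidableEq ι]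
    (C : Submodule F (ι → F)) {a : ℝ} (h : ∀ c ∈ C, c ≠ 0 → a ≤ hammingNorm c) :
    ((⌈a⌉₊ : ℕ) : ℕ∞) ≤ minDist C :=
  le_minDist_iff.2 fun c hc h0 => by exact_mod_cast Nat.ceil_le.2 (h c hc h0)

/-- **Binary dual distance from symbol dual distance** (Lemma 25 in inequality form, any basis):
every nonzero binary word orthogonal to the binary image of `D` has weight `≥ ⌈a⌉` as soon as
every nonzero `𝔽₆₄`-word orthogonal to `D` has weight `≥ a`.
[cite: Shpilka2009, App. A, Lemma 25–26 (p. 26)] -/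
theorem le_hammingNorm_of_dual_binaryImage {i : ℕ} (D : Submodule F64 (Fin (agLength i) → F64))
    {a : ℝ} (hD : ∀ y : Fin (agLength i) → F64, (∀ d ∈ D, d ⬝ᵥ y = 0) → y ≠ 0 → a ≤ hammingNorm y)
    (w : Fin (hwLength i) → ZMod 2) (hw : ∀ c ∈ binaryImage i D, c ⬝ᵥ w = 0) (hw0 : w ≠ 0) :
    a ≤ hammingNorm w := by
  have h1 : ((⌈a⌉₊ : ℕ) : ℕ∞) ≤ dualDist (binaryImage i D) :=
    calc ((⌈a⌉₊ : ℕ) : ℕ∞) ≤ dualDist D := ceil_le_dualDist D hD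
      _ ≤ dualDist (subfieldImage basis64 D) := dualDist_le_dualDist_subfieldImage basis64 D
      _ = dualDist (binaryImage i D) := (dualDist_reindex (binIdx i) _).symm
  have h2 : ⌈a⌉₊ ≤ hammingNorm w := by exact_mod_cast le_dualDist_iff.1 h1 w hw hw0
  exact (Nat.le_ceil a).trans (by exact_mod_cast h2)

/-- **Binary distance from symbol distance** (Lemma 26, distance part, any basis): every
nonzero binary codeword of the image has weight `≥ ⌈a⌉` as soon as every nonzero codeword of `D`
has weight `≥ a`. [cite: Shpilka2009, App. A, Lemma 26 (p. 26)] -/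
theorem le_hammingNorm_of_mem_binaryImage {i : ℕ} (D : Submodule F64 (Fin (agLength i) → F64))
    {a : ℝ} (hD : ∀ d ∈ D, d ≠ 0 → a ≤ hammingNorm d)
    (c : Fin (hwLength i) → ZMod 2) (hc : c ∈ binaryImage i D) (hc0 : c ≠ 0) :
    a ≤ hammingNorm c := by
  have h1 : ((⌈a⌉₊ : ℕ) : ℕ∞) ≤ minDist (binaryImage i D) :=
    calc ((⌈a⌉₊ : ℕ) : ℕ∞) ≤ minDist D := ceil_le_minDist D hD
      _ ≤ minDist (subfieldImage basis64 D) := minDist_le_minDist_subfieldImage basis64 D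
      _ = minDist (binaryImage i D) := (minDist_reindex (binIdx i) _).symm
  have h2 : ⌈a⌉₊ ≤ hammingNorm c := by exact_mod_cast le_minDist_iff.1 h1 c hc hc0
  exact (Nat.le_ceil a).trans (by exact_mod_cast h2)

/-- **Prop. 3 from `𝔽₆₄`-codes with the parameters of Thm. 24** (the conclusion of Appendix A,
p. 26, as a reduction with explicit hypotheses). Given `𝔽₆₄`-linear codes `D_i ≤ 𝔽₆₄^{N_i}`,
`N_i = 7·8^{i+2}`, such that (a) every nonzero word orthogonal to `D_i` has weight `≥ N_i/3`,
(b) every nonzero codeword has weight `≥ (1/2 - 1/7)N_i`, and (c) for every rational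
`0 < θ ≤ 1/60` the bounded-distance problem of the binary images `binaryImage i (D_i)` at relative
radius `θ` is in `P` (Thm. 24 at `r = 8`: "deterministic polynomial time decoding from a fraction
`1/10` of errors", with Lemma 26: a fraction `1/60` for the binary image), the binary images
`C_i` satisfy `DecodableDualDistanceCodes` with `ζ = 1/30`: (a) binary dual distance
`≥ N_i/3 = n_i/18 ≥ ζ n_i` (Lemma 25 in inequality form); (b) binary distance
`≥ (1/2 - 1/7)N_i = 5n_i/84 > n_i/30 ≥ 2⌊ζ n_i/2⌋` (Lemma 26); (c) decoding radius `θ ≤ ζ/2 = 1/60`.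
In print (p. 26): binary codes of length `42·8^{m+1}` "decodable in deterministic polynomial time
from a fraction `1/60` of errors and whose duals have relative distance at least `1/18`", i.e.
Thm. 4 of Shpilka 2009 = Holmgren–Wein's Prop. 3. Thm. 24's rate `1/2` plays no role in Prop. 3
and is not assumed. The hypotheses are exactly what is not formalised (the Garcia–Stichtenoth
tower behind (a)–(b), see `LowDegreeCounterexamplesCodes64GS.lean`, and the machine-level decoder
(c)); they are hypotheses of this theorem, not a named fact (D-0026).
[cite: Shpilka2009, Thm. 4 (p. 7); App. A, Thm. 24 (p. 25), Lemmas 25–26 and p. 26] -/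
theorem DecodableDualDistanceCodes.of_codes64 (D : ∀ i : ℕ, Submodule F64 (Fin (agLength i) → F64))
    (hdual : ∀ i, ∀ y : Fin (agLength i) → F64, (∀ d ∈ D i, d ⬝ᵥ y = 0) → y ≠ 0 →
      (agLength i : ℝ) / 3 ≤ hammingNorm y)
    (hdist : ∀ i, ∀ d ∈ D i, d ≠ 0 → (1 / 2 - 1 / 7 : ℝ) * agLength i ≤ hammingNorm d)
    (hP : ∀ θ : ℚ, 0 < θ → θ ≤ 1 / 60 →
      bddLanguage (fun i => binaryImage i (D i)) θ ∈ Literature.Computability.Complexity.Classes.P) :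
    DecodableDualDistanceCodes := by
  refine ⟨1 / 30, le_rfl, fun i => binaryImage i (D i), fun i y hy hy0 => ?_,
    fun i c hc hc0 => ?_, fun θ hθ hθ' => hP θ hθ ?_⟩
  · -- (a) dual distance: `n/30 ≤ N/3 ≤ ‖y‖`
    have hN : (hwLength i : ℝ) = 6 * agLength i := by
      rw [← agLength_mul_six]; push_cast; ring
    have h1 := le_hammingNorm_of_dual_binaryImage (D i) (hdual i) y
      (fun c hc => by rw [dotProduct_comm]; exact hy c hc) hy0
    have h0 : (0 : ℝ) ≤ agLength i := Nat.cast_nonneg _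
    rw [hN]
    linarith
  · -- (b) distance: `2⌊n/60⌋ ≤ n/30 = N/5 < (1/2 - 1/7) N ≤ ‖c‖`
    have hN : (hwLength i : ℝ) = 6 * agLength i := by
      rw [← agLength_mul_six]; push_cast; ring
    have h1 := le_hammingNorm_of_mem_binaryImage (D i) (hdist i) c hc hc0
    have hpos : (0 : ℝ) < agLength i := by exact_mod_cast agLength_pos i
    have hfloor : (⌊(1 / 30 : ℝ) * hwLength i / 2⌋₊ : ℝ) ≤ 1 / 30 * hwLength i / 2 :=
      Nat.floor_le (by positivity)
    have key : (2 * ⌊(1 / 30 : ℝ) * hwLength i / 2⌋₊ : ℝ) < hammingNorm c := by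
      rw [hN] at hfloor ⊢
      linarith
    exact_mod_cast key
  · -- (c) decoding radius `θ ≤ ζ/2 = 1/60`
    have h1 : (θ : ℝ) ≤ 1 / 30 / 2 := hθ'
    have h2 : ((θ : ℚ) : ℝ) ≤ ((1 / 60 : ℚ) : ℝ) := by
      push_cast
      linarith
    exact Rat.cast_le.1 h2

/-- Hence the barrier fact from such `𝔽₆₄`-codes: Holmgren–Wein's Thm. 2 with every step but the
algebraic-geometry codes (hypotheses (a)–(b)) and their machine-level decoder (hypothesis (c))
formalised. [cite: HolmgrenWein2021, Thm. 2 and Prop. 3 (arXiv pp. 6–7)] -/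
theorem LowDegreeCounterexamples.of_codes64 (D : ∀ i : ℕ, Submodule F64 (Fin (agLength i) → F64))
    (hdual : ∀ i, ∀ y : Fin (agLength i) → F64, (∀ d ∈ D i, d ⬝ᵥ y = 0) → y ≠ 0 →
      (agLength i : ℝ) / 3 ≤ hammingNorm y)
    (hdist : ∀ i, ∀ d ∈ D i, d ≠ 0 → (1 / 2 - 1 / 7 : ℝ) * agLength i ≤ hammingNorm d)
    (hP : ∀ θ : ℚ, 0 < θ → θ ≤ 1 / 60 →
      bddLanguage (fun i => binaryImage i (D i)) θ ∈ Literature.Computability.Complexity.Classes.P) :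
    LowDegreeCounterexamples :=
  LowDegreeCounterexamples.of_codes (DecodableDualDistanceCodes.of_codes64 D hdual hdist hP)

end Literature.Barriers.PneNP

end
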